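import Summits.KontsevichZagierPeriods.KontsevichZagierPeriods.Theorems.RootDecompRelativeModAbsoluteCylLogSplitP09

/-! # `RootDecompRelativeModAbsoluteCylLogSplitP10` — part 10/25 of the mechanical ≤330-line split of `CylLogSplit.lean`
(split by the decomp-kz census seat for landing; mathematics unchanged; part 10 continues part 9). -/

noncomputable section
open Set MeasureTheory Filter Topology
open scoped BigOperators
open Literature.NumberTheory.Transcendental Literature.ModelTheory.ExponentialFields

namespace Summit.KontsevichZagierPeriods.RootDecompRelativeModAbsolute.Rung30571

namespace RegularisedLogLayer

namespace CylLog
variable {b : ℕ}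

/-- **Open cell → closed band.**  A representation on the open cell `{x ∈ G, a(x) < t < c(x)}` is congruent
modulo `KZ.relations` to one on the closed band `KZlog.band G a c` with the same integrand on the cell. -/
theorem exists_closedBand_of_openCell {b : ℕ} {G : Set (Fin b → ℝ)} {a c : (Fin b → ℝ) → ℝ}
    (ha : IsSemialgebraicFunOn ℚ G a) (hc : IsSemialgebraicFunOn ℚ G c) (r : KZ.IntegralRep (b + 1))
    (hrd : r.domain = {z | (Fin.init z : Fin b → ℝ) ∈ G ∧ a (Fin.init z) < z (Fin.last b) ∧
      z (Fin.last b) < c (Fin.init z)}) :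
    ∃ r' : KZ.IntegralRep (b + 1), r'.domain = KZlog.band G a c ∧
      EqOn r'.integrand r.integrand r.domain ∧ KZ.of r - KZ.of r' ∈ KZ.relations := by
  have hband : IsSemialgebraic ℚ (KZlog.band G a c) := KZlog.isSemialgebraic_band ha hc
  have hsub : r.domain ⊆ KZlog.band G a c := fun z hz => by
    rw [hrd] at hz
    exact ⟨hz.1, hz.2.1.le, hz.2.2.le⟩
  have hdiff_sub : KZlog.band G a c \ r.domain ⊆
      {z : Fin (b + 1) → ℝ | Fin.init z ∈ G ∧ z (Fin.last b) = a (Fin.init z)} ∪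
        {z : Fin (b + 1) → ℝ | Fin.init z ∈ G ∧ z (Fin.last b) = c (Fin.init z)} := by
    rintro z ⟨⟨hx, h1, h2⟩, hzr⟩
    rw [hrd] at hzr
    by_cases hza : z (Fin.last b) = a (Fin.init z)
    · exact Or.inl ⟨hx, hza⟩
    · right
      refine ⟨hx, ?_⟩
      have hlt : a (Fin.init z) < z (Fin.last b) := lt_of_le_of_ne h1 (Ne.symm hza)
      by_contra hne
      exact hzr ⟨hx, hlt, lt_of_le_of_ne h2 hne⟩
  have hnull : volume (KZlog.band G a c \ r.domain) = 0 :=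
    measure_mono_null hdiff_sub
      (measure_union_null (KZ.volume_graph_eq_zero ha) (KZ.volume_graph_eq_zero hc))
  set g : (Fin (b + 1) → ℝ) → ℝ := r.domain.indicator r.integrand with hg
  have hg_mem : ∀ z ∈ r.domain, g z = r.integrand z := fun z hz => by
    simp [hg, indicator_of_mem hz]
  have hg_nmem : ∀ z ∉ r.domain, g z = 0 := fun z hz => by
    simp [hg, indicator_of_notMem hz]
  have hsa : IsSemialgebraicFunOn ℚ (KZlog.band G a c) g := by
    have h := IsSemialgebraicFunOn.union r.isSemialgebraicFunOn_integrand
      (isSemialgebraicFunOn_ratCast (hband.diff r.isSemialgebraic_domain) 0) (F := g)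
      (fun z hz => hg_mem z hz) (fun z hz => by simpa using hg_nmem z hz.2)
    rwa [union_sdiff_cancel hsub] at h
  have hint : IntegrableOn g (KZlog.band G a c) := by
    have h1 : IntegrableOn g r.domain :=
      r.integrableOn.congr_fun (fun z hz => (hg_mem z hz).symm)
        (KZ.IntegralRep.measurableSet_domain_holds r)
    have h2 : IntegrableOn g (KZlog.band G a c \ r.domain) := by
      rw [IntegrableOn, Measure.restrict_eq_zero.mpr hnull]
      exact integrable_zero_measure
    have h := h1.union h2
    rwa [union_sdiff_cancel hsub] at h
  let r' : KZ.IntegralRep (b + 1) :=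
    { domain := KZlog.band G a c
      integrand := g
      isSemialgebraic_domain := hband
      isSemialgebraicFunOn_integrand := hsa
      integrableOn := hint }
  refine ⟨r', rfl, fun z hz => hg_mem z hz, ?_⟩
  refine AECongr.of_sub_of_mem_relations_of_indicator_ae r r' ?_
  filter_upwards [compl_mem_ae_iff.2 hnull] with x hx
  by_cases hxr : x ∈ r.domain
  · show r.domain.indicator r.integrand x = (KZlog.band G a c).indicator g x
    rw [indicator_of_mem hxr, indicator_of_mem (hsub hxr), hg_mem x hxr]
  · have hxb : x ∉ KZlog.band G a c := fun hxb => hx ⟨hxb, hxr⟩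
    show r.domain.indicator r.integrand x = (KZlog.band G a c).indicator g x
    rw [indicator_of_notMem hxr, indicator_of_notMem hxb]

/-! ### §3k Constructing the regularised representation from an honest cylinder term (glue D4, existence) — PROVED

`cyl_sub_reg_mem_relations` takes the regularised representation as GIVEN; the glue must also BUILD it
(with its integrability) from the honest cylinder term.  The fibre identity
`∫_{[1,1+κ]} |c/κ^{M+1}·(t−1)^M/t| dt = ∫_{[0,1]} |c·θ^M/(1+θκ)| dθ` does this through Tonelli
(`integrableOn_fibre_abs_band`, `KZlog.integrableOn_band_of_lintegral_fibre_le`).  Also recorded: the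
open-cell → closed-band passage with a PRESCRIBED semialgebraic integrand on the band (the form the glue
actually consumes: the band lemmas want `EqOn` on the closed band, not only on the open cell). -/

/-- **Open cell → closed band, prescribed integrand.** -/
theorem exists_closedBand_of_openCell' {b : ℕ} {G : Set (Fin b → ℝ)} {a c : (Fin b → ℝ) → ℝ}
    (ha : IsSemialgebraicFunOn ℚ G a) (hc : IsSemialgebraicFunOn ℚ G c) (r : KZ.IntegralRep (b + 1))
    (hrd : r.domain = {z | (Fin.init z : Fin b → ℝ) ∈ G ∧ a (Fin.init z) < z (Fin.last b) ∧
      z (Fin.last b) < c (Fin.init z)})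
    (F : (Fin (b + 1) → ℝ) → ℝ) (hF : IsSemialgebraicFunOn ℚ (KZlog.band G a c) F)
    (hrF : EqOn r.integrand F r.domain) :
    ∃ r' : KZ.IntegralRep (b + 1), r'.domain = KZlog.band G a c ∧ r'.integrand = F ∧
      KZ.of r - KZ.of r' ∈ KZ.relations := by
  have hband : IsSemialgebraic ℚ (KZlog.band G a c) := KZlog.isSemialgebraic_band ha hc
  have hsub : r.domain ⊆ KZlog.band G a c := fun z hz => by
    rw [hrd] at hz
    exact ⟨hz.1, hz.2.1.le, hz.2.2.le⟩
  have hdiff_sub : KZlog.band G a c \ r.domain ⊆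
      {z : Fin (b + 1) → ℝ | Fin.init z ∈ G ∧ z (Fin.last b) = a (Fin.init z)} ∪
        {z : Fin (b + 1) → ℝ | Fin.init z ∈ G ∧ z (Fin.last b) = c (Fin.init z)} := by
    rintro z ⟨⟨hx, h1, h2⟩, hzr⟩
    rw [hrd] at hzr
    by_cases hza : z (Fin.last b) = a (Fin.init z)
    · exact Or.inl ⟨hx, hza⟩
    · right
      refine ⟨hx, ?_⟩
      have hlt : a (Fin.init z) < z (Fin.last b) := lt_of_le_of_ne h1 (Ne.symm hza)
      by_contra hne
      exact hzr ⟨hx, hlt, lt_of_le_of_ne h2 hne⟩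
  have hnull : volume (KZlog.band G a c \ r.domain) = 0 :=
    measure_mono_null hdiff_sub
      (measure_union_null (KZ.volume_graph_eq_zero ha) (KZ.volume_graph_eq_zero hc))
  have hint : IntegrableOn F (KZlog.band G a c) := by
    have h1 : IntegrableOn F r.domain :=
      r.integrableOn.congr_fun hrF (KZ.IntegralRep.measurableSet_domain_holds r)
    have h2 : IntegrableOn F (KZlog.band G a c \ r.domain) := by
      rw [IntegrableOn, Measure.restrict_eq_zero.mpr hnull]
      exact integrable_zero_measure
    have h := h1.union h2
    rwa [union_sdiff_cancel hsub] at h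
  let r' : KZ.IntegralRep (b + 1) :=
    { domain := KZlog.band G a c
      integrand := F
      isSemialgebraic_domain := hband
      isSemialgebraicFunOn_integrand := hF
      integrableOn := hint }
  refine ⟨r', rfl, rfl, ?_⟩
  refine AECongr.of_sub_of_mem_relations_of_indicator_ae r r' ?_
  filter_upwards [compl_mem_ae_iff.2 hnull] with x hx
  by_cases hxr : x ∈ r.domain
  · show r.domain.indicator r.integrand x = (KZlog.band G a c).indicator F x
    rw [indicator_of_mem hxr, indicator_of_mem (hsub hxr), hrF hxr]
  · have hxb : x ∉ KZlog.band G a c := fun hxb => hx ⟨hxb, hxr⟩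
    show r.domain.indicator r.integrand x = (KZlog.band G a c).indicator F x
    rw [indicator_of_notMem hxr, indicator_of_notMem hxb]

/-- The fibre identity behind D4 (`κ > 0`, `t = 1 + κθ`):
`∫_{[1,1+k]} |c/k^{M+1}·(t−1)^M/t| dt = ∫_{[0,1]} |c·θ^M/(1+θk)| dθ`. -/
theorem integral_abs_regKernel_eq (M : ℕ) (c : ℝ) {k : ℝ} (hk : 0 < k) :
    ∫ t in Icc 1 (1 + k), |c / k ^ (M + 1) * ((t - 1) ^ M / t)| =
      ∫ θ in Icc 0 1, |c * (θ ^ M / (1 + θ * k))| := by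
  set ψ : ℝ → ℝ := fun t => |c / k ^ (M + 1) * ((t - 1) ^ M / t)| with hψ
  set φ : ℝ → ℝ := fun θ => |c * (θ ^ M / (1 + θ * k))| with hφ
  have hk0 : k ≠ 0 := hk.ne'
  have hpt : ∀ θ ∈ Icc (0:ℝ) 1, k * ψ (k * θ + 1) = φ θ := by
    intro θ hθ
    have hθ0 : 0 ≤ θ := hθ.1
    have hden : k * θ + 1 ≠ 0 := by positivity
    have hden' : 1 + θ * k ≠ 0 := by positivity
    have key : k * (c / k ^ (M + 1) * ((k * θ + 1 - 1) ^ M / (k * θ + 1))) =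
        c * (θ ^ M / (1 + θ * k)) := by
      rw [add_sub_cancel_right, mul_pow, pow_succ]
      field_simp
      ring
    show k * |c / k ^ (M + 1) * ((k * θ + 1 - 1) ^ M / (k * θ + 1))| =
      |c * (θ ^ M / (1 + θ * k))|
    rw [← key]
    conv_rhs => rw [abs_mul, abs_of_pos hk]
  have h1 : ∫ t in Icc 1 (1 + k), ψ t = ∫ t in (1:ℝ)..1 + k, ψ t := by
    rw [intervalIntegral.integral_of_le (by linarith), integral_Icc_eq_integral_Ioc]
  have h2 : ∫ θ in Icc (0:ℝ) 1, φ θ = ∫ θ in (0:ℝ)..1, φ θ := by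
    rw [intervalIntegral.integral_of_le zero_le_one, integral_Icc_eq_integral_Ioc]
  have h3 : k * ∫ θ in (0:ℝ)..1, ψ (k * θ + 1) = ∫ t in k * 0 + 1..k * 1 + 1, ψ t :=
    intervalIntegral.mul_integral_comp_mul_add k 1
  rw [h1, h2]
  calc ∫ t in (1:ℝ)..1 + k, ψ t = ∫ t in k * 0 + 1..k * 1 + 1, ψ t := by
        simp only [mul_zero, zero_add, mul_one, add_comm]
    _ = k * ∫ θ in (0:ℝ)..1, ψ (k * θ + 1) := h3.symm
    _ = ∫ θ in (0:ℝ)..1, k * ψ (k * θ + 1) := (intervalIntegral.integral_const_mul k _).symm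
    _ = ∫ θ in (0:ℝ)..1, φ θ :=
        intervalIntegral.integral_congr fun θ hθ => hpt θ (by rwa [uIcc_of_le zero_le_one] at hθ)

/-- Lintegral form of the fibre identity, as consumed by `KZlog.integrableOn_band_of_lintegral_fibre_le`. -/
theorem lintegral_regKernel_le (M : ℕ) (c : ℝ) {k : ℝ} (hk : 0 < k) :
    ∫⁻ t in Icc 1 (1 + k), ‖c / k ^ (M + 1) * ((t - 1) ^ M / t)‖ₑ ≤
      ‖∫ θ in Icc 0 1, |c * (θ ^ M / (1 + θ * k))|‖ₑ := by
  set g : ℝ → ℝ := fun t => c / k ^ (M + 1) * ((t - 1) ^ M / t) with hg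
  have hg_cont : ContinuousOn g (Icc 1 (1 + k)) := by
    have h := continuousOn_scaled_kernel M (c / k ^ (M + 1)) 1 (Icc 1 (1 + k))
      (fun t ht => (zero_lt_one.trans_le ht.1).ne')
    simpa [hg] using h
  have hg_int : IntegrableOn g (Icc 1 (1 + k)) := hg_cont.integrableOn_compact isCompact_Icc
  have hL : ∫⁻ t in Icc 1 (1 + k), ‖g t‖ₑ = ENNReal.ofReal (∫ t in Icc 1 (1 + k), ‖g t‖) :=
    (ofReal_integral_norm_eq_lintegral_enorm hg_int).symm
  have hK_nonneg : 0 ≤ ∫ θ in Icc (0:ℝ) 1, |c * (θ ^ M / (1 + θ * k))| :=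
    setIntegral_nonneg measurableSet_Icc fun _ _ => abs_nonneg _
  show ∫⁻ t in Icc 1 (1 + k), ‖g t‖ₑ ≤ _
  rw [hL, Real.enorm_eq_ofReal hK_nonneg]
  refine ENNReal.ofReal_le_ofReal (le_of_eq ?_)
  rw [← integral_abs_regKernel_eq M c hk]
  exact setIntegral_congr_fun measurableSet_Icc fun t _ => by simp only [hg, Real.norm_eq_abs]

/-- **D4 existence (`κ > 0`):** the regularised representation `[{1≤t≤1+κ}, (c/κ^{M+1})(t−1)^M/t]` is honest
whenever the cylinder term `[{0≤θ≤1}, cθ^M/(1+θκ)]` is (same absolute fibre integrals). -/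
theorem exists_regRep_of_cyl {b M : ℕ} {G : Set (Fin b → ℝ)} {c κ : (Fin b → ℝ) → ℝ}
    (hG : IsSemialgebraic ℚ G) (hc : IsSemialgebraicFunOn ℚ G c) (hκ : IsSemialgebraicFunOn ℚ G κ)
    (hκ0 : ∀ x ∈ G, 0 < κ x) (Cy : KZ.IntegralRep (b + 1))
    (hCd : Cy.domain = KZlog.band G (fun _ => 0) (fun _ => 1))
    (hCi : EqOn Cy.integrand (fun z => c (Fin.init z) *
      (z (Fin.last b) ^ M / (1 + z (Fin.last b) * κ (Fin.init z)))) Cy.domain) :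
    ∃ Rg : KZ.IntegralRep (b + 1), Rg.domain = KZlog.band G (fun _ => 1) (fun x => 1 + κ x) ∧
      Rg.integrand = fun z =>
        c (Fin.init z) / κ (Fin.init z) ^ (M + 1) * ((z (Fin.last b) - 1) ^ M / z (Fin.last b)) := by
  have h1sa : IsSemialgebraicFunOn ℚ G (fun _ => (1:ℝ)) :=
    (isSemialgebraicFunOn_ratCast hG 1).congr fun _ _ => by simp
  have hWsa : IsSemialgebraicFunOn ℚ G (fun x => 1 + κ x) := IsSemialgebraicFunOn.add_holds h1sa hκ
  have hbsa : IsSemialgebraic ℚ (KZlog.band G (fun _ => (1:ℝ)) (fun x => 1 + κ x)) :=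
    KZlog.isSemialgebraic_band h1sa hWsa
  have hGm : MeasurableSet G := hG.measurableSet_holds
  have hBm : MeasurableSet (KZlog.band G (fun _ => (1:ℝ)) (fun x => 1 + κ x)) :=
    hbsa.measurableSet_holds
  have hband_sub : KZlog.band G (fun _ => (1:ℝ)) (fun x => 1 + κ x) ⊆
      {z : Fin (b + 1) → ℝ | Fin.init z ∈ G} := fun z hz => hz.1
  have hcI : IsSemialgebraicFunOn ℚ (KZlog.band G (fun _ => (1:ℝ)) (fun x => 1 + κ x))
      (fun z => c (Fin.init z)) := hc.comp_init.mono hband_sub hbsa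
  have hκI : IsSemialgebraicFunOn ℚ (KZlog.band G (fun _ => (1:ℝ)) (fun x => 1 + κ x))
      (fun z => κ (Fin.init z)) := hκ.comp_init.mono hband_sub hbsa
  have hsI : IsSemialgebraicFunOn ℚ (KZlog.band G (fun _ => (1:ℝ)) (fun x => 1 + κ x))
      (fun z => z (Fin.last b)) := isSemialgebraicFunOn_apply hbsa (Fin.last b)
  have hs1 : IsSemialgebraicFunOn ℚ (KZlog.band G (fun _ => (1:ℝ)) (fun x => 1 + κ x))
      (fun z => z (Fin.last b) - 1) :=
    (IsSemialgebraicFunOn.sub_holds hsI (isSemialgebraicFunOn_ratCast hbsa 1)).congr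
      fun z _ => by simp
  have hs0 : ∀ z ∈ KZlog.band G (fun _ => (1:ℝ)) (fun x => 1 + κ x), z (Fin.last b) ≠ 0 :=
    fun z hz => (zero_lt_one.trans_le hz.2.1).ne'
  have hκ0' : ∀ z ∈ KZlog.band G (fun _ => (1:ℝ)) (fun x => 1 + κ x),
      κ (Fin.init z) ^ (M + 1) ≠ 0 := fun z hz => pow_ne_zero _ (hκ0 _ hz.1).ne'
  have hRsa : IsSemialgebraicFunOn ℚ (KZlog.band G (fun _ => (1:ℝ)) (fun x => 1 + κ x))
      (fun z => c (Fin.init z) / κ (Fin.init z) ^ (M + 1) *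
        ((z (Fin.last b) - 1) ^ M / z (Fin.last b))) :=
    IsSemialgebraicFunOn.mul_holds
      (IsSemialgebraicFunOn.div hcI (isSemialgebraicFunOn_pow' hbsa hκI (M + 1)) hκ0')
      (IsSemialgebraicFunOn.div (isSemialgebraicFunOn_pow' hbsa hs1 M) hsI hs0)
  have hK : IntegrableOn (fun x => ∫ t in Icc ((fun _ : Fin b → ℝ => (0:ℝ)) x)
      ((fun _ : Fin b → ℝ => (1:ℝ)) x), |c x * (t ^ M / (1 + t * κ x))|) G :=
    integrableOn_fibre_abs_band Cy hCd hGm (F := fun x t => c x * (t ^ M / (1 + t * κ x)))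
      fun x hx t ht => by
        have hmem : (Fin.snoc x t : Fin (b + 1) → ℝ) ∈ Cy.domain := by
          rw [hCd, KZlog.snoc_mem_band]; exact ⟨hx, ht⟩
        rw [hCi hmem]
        simp only [Fin.init_snoc, Fin.snoc_last]
  have hRint : IntegrableOn
      (fun z : Fin (b + 1) → ℝ => c (Fin.init z) / κ (Fin.init z) ^ (M + 1) *
        ((z (Fin.last b) - 1) ^ M / z (Fin.last b)))
      (KZlog.band G (fun _ => (1:ℝ)) (fun x => 1 + κ x)) := by
    refine KZlog.integrableOn_band_of_lintegral_fibre_le hGm (a := fun _ => (1:ℝ))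
      (b := fun x => 1 + κ x) hBm (fun x t => KZlog.snoc_mem_band)
      (KZ.aestronglyMeasurable_of_isSemialgebraicFunOn hRsa hBm)
      (K := fun x => ∫ t in Icc (0:ℝ) 1, |c x * (t ^ M / (1 + t * κ x))|) (fun x hx => ?_) hK
    simp only [Fin.init_snoc, Fin.snoc_last]
    exact lintegral_regKernel_le M (c x) (hκ0 x hx)
  exact ⟨{ domain := KZlog.band G (fun _ => (1:ℝ)) (fun x => 1 + κ x)
           integrand := fun z => c (Fin.init z) / κ (Fin.init z) ^ (M + 1) *
             ((z (Fin.last b) - 1) ^ M / z (Fin.last b))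
           isSemialgebraic_domain := hbsa
           isSemialgebraicFunOn_integrand := hRsa
           integrableOn := hRint }, rfl, rfl⟩

/-- **D4 packaged (`κ > 0`):** existence of the regularised representation AND the relation. -/
theorem exists_regRep_sub_mem_relations {b M : ℕ} {G : Set (Fin b → ℝ)} {c κ : (Fin b → ℝ) → ℝ}
    (hGo : IsOpen G) (hG : IsSemialgebraic ℚ G) (hc : IsSemialgebraicFunOn ℚ G c)
    (hκ : IsSemialgebraicFunOn ℚ G κ) (hκd : DifferentiableOn ℝ κ G) (hκ0 : ∀ x ∈ G, 0 < κ x)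
    (Cy : KZ.IntegralRep (b + 1)) (hCd : Cy.domain = KZlog.band G (fun _ => 0) (fun _ => 1))
    (hCi : EqOn Cy.integrand (fun z => c (Fin.init z) *
      (z (Fin.last b) ^ M / (1 + z (Fin.last b) * κ (Fin.init z)))) Cy.domain) :
    ∃ Rg : KZ.IntegralRep (b + 1), Rg.domain = KZlog.band G (fun _ => 1) (fun x => 1 + κ x) ∧
      (Rg.integrand = fun z =>
        c (Fin.init z) / κ (Fin.init z) ^ (M + 1) * ((z (Fin.last b) - 1) ^ M / z (Fin.last b))) ∧
      KZ.of Cy - KZ.of Rg ∈ KZ.relations := by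
  obtain ⟨Rg, hRd, hRi⟩ := exists_regRep_of_cyl (M := M) hG hc hκ hκ0 Cy hCd hCi
  exact ⟨Rg, hRd, hRi, cyl_sub_reg_mem_relations hGo hG hκ hκd hκ0 Cy Rg hCd hCi hRd
    fun z _ => by rw [hRi]⟩

end CylLog
end RegularisedLogLayer
end Summit.KontsevichZagierPeriods.RootDecompRelativeModAbsolute.Rung30571
end
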